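import Summits.BirchSwinnertonDyer.BirchSwinnertonDyer.Theorems.ClassRecordThreeEulerHalvesAtThreeWalkSupplyCarrier
import HarnessLib

/-!
# The walk's CARRIER at a bad prime `q ∉ S` SPLIT in `K`, WITHOUT the Heegner hypothesis — the curve-side variant of tam3-p1's
# `JET.Walk.exists_stringentCarrier` ∕ bsd-jet's `JET.exists_split_place_of_dvd` for the Shimura frames of the carrier-inert road
# (cell `bsd-stepL`, seat `bsd-stepL-corner3-p2` g8 = WIDTH-LEVER lane B; `--supports stmt-BirchSwinnertonDyer-21420 --as helper`)

WHY (tam3-p1 g12 PORT MAP (P2) §2, last paragraph: «curve-side, reusable VERBATIM … EXCEPT that `exists_stringentCarrier` ∕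
`exists_split_place_of_dvd` assume `SatisfiesHeegnerHypothesis N K` (all primes of `N` split): on the Shimura frames only the primes `∉ S`
split (`hsp`); a variant keyed on «`q₁ ∉ S` splits» is needed»). On the frames of the port targets `ShimuraWalk.LevelSupplyAtThree(B6)`
(p592703 ∕ RULING 47) the primes of `S` (among them `3`) are INERT in `K` and the per-level inequality is asked only at the bad primes
`q ∉ S`, which split: `((Ideal.span {(q : ℤ)}).primesOver (𝓞 K)).ncard = 2` (clause `hsp`). Both tree theorems use the Heegner hypothesis
ONLY through that cardinality at the one prime `q` under the carrier place. THIS FILE re-proves them from the cardinality alone: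
* `exists_split_place_of_ncard_eq_two` — `τ • v₀ ≠ v₀`, `N ∈ v₀`, `q ∈ v₀` for a place `v₀` of `K` over a prime `q ∣ N` with exactly two
  primes of `K` above it (Cassels–Fröhlich VII Prop. 1.2 (ii): `Gal(K/ℚ)` permutes them); proof = bsd-jet's, verbatim;
* `exists_stringentCarrier_of_ncard_eq_two` — tam3-p1's stringent carrier (the place `v₀`, `𝒮 :=` Jetchev's stringent family `≤ Kum`,
  `τ`-stability, (δ) `Kum_{v₀}∕𝒮_{v₀}` cyclic of order `p^{ord_p c_v(E)}`) with `SatisfiesHeegnerHypothesis` replaced by «the prime under the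
  stub's place `v` has two primes of `K` above it» (hypothesis `hsp`, the shape of the frame clause); proof = tam3-p1's, verbatim.
HONEST FRAMING: theorems only (no definition, no named fact, no `sorry`); curve-side plumbing; nothing about any Heegner ∕ CM point; no stub
closes; BSD is not proved by any of this; T7. Credit: bsd-jet pv (split place), tam3-p1 g8 (stringent carrier).
References: [cite: CasselsFrohlichANT1967, Ch. VII Prop. 1.2 (ii)] [cite: Jetchev2008, Lemma 3.2 (p. 814), (δ) (p. 822)] [cite: SilvermanAEC2009, X.§4].
presearch: not applicable (hypothesis-weakening of two tree theorems); `lean search 'of_ncard_eq_two'` → only quadratic-field generalities.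
-/

set_option autoImplicit false
set_option linter.dupNamespace false

noncomputable section

open scoped Classical Pointwise
open Function NumberField IsDedekindDomain WeierstrassCurve Field
open Literature.NumberTheory.EllipticCurves Literature.NumberTheory.GaloisRepresentations
open Literature.NumberTheory.EllipticCurves.Jetchev2008
open Literature.NumberTheory.GaloisCohomology Literature.NumberTheory.Automorphic
open Summit.BirchSwinnertonDyer.Rank1Residual.JET Summit.BirchSwinnertonDyer.Rank1Residual.JET.SelmerVocabulary
  Summit.BirchSwinnertonDyer.Rank1Residual.JET.Walk

namespace Summit.BirchSwinnertonDyer.BirchSwinnertonDyer.Theorems.ShimuraWalk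

/-- **The split place over a prime with two primes of `K` above it.** For `K` imaginary quadratic, `τ ≠ 1` in `Aut(K/ℚ)`, a prime `q ∣ N`
with `((q).primesOver 𝓞_K).ncard = 2`: there is a place `v₀ ∋ q` of `K` with `τ • v₀ ≠ v₀` and `N ∈ v₀` — bsd-jet's
`JET.exists_split_place_of_dvd` with the Heegner hypothesis replaced by the cardinality at `q` (proof verbatim).
[cite: CasselsFrohlichANT1967, Ch. VII Prop. 1.2 (ii)] -/
theorem exists_split_place_of_ncard_eq_two {N : ℕ} (K : Type) [Field K] [NumberField K]
    (hK : IsImaginaryQuadratic K) (τ : K ≃ₐ[ℚ] K) (hτ : τ ≠ 1)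
    (q : ℕ) [Fact q.Prime] (hq2 : ((Ideal.span {(q : ℤ)}).primesOver (𝓞 K)).ncard = 2) (hqN : q ∣ N) :
    ∃ v₀ : HeightOneSpectrum (𝓞 K), τ • v₀ ≠ v₀ ∧ ((N : ℕ) : 𝓞 K) ∈ v₀.asIdeal ∧
      ((q : ℕ) : 𝓞 K) ∈ v₀.asIdeal := by
  -- adapted verbatim from bsd-jet's `JET.exists_split_place_of_dvd` (hypothesis `hH q hq hqN` ↦ `hq2`)
  have hq : q.Prime := Fact.out
  haveI : Algebra.IsQuadraticExtension ℚ K := ⟨hK.1⟩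
  obtain ⟨P₁, P₂, hne, hset⟩ := Set.ncard_eq_two.mp hq2
  have hP₁ : P₁ ∈ (Ideal.span {(q : ℤ)}).primesOver (𝓞 K) := by rw [hset]; exact Set.mem_insert _ _
  have hP₂ : P₂ ∈ (Ideal.span {(q : ℤ)}).primesOver (𝓞 K) := by
    rw [hset]; exact Set.mem_insert_of_mem _ rfl
  have hmemq : ∀ P ∈ (Ideal.span {(q : ℤ)}).primesOver (𝓞 K), ((q : ℕ) : 𝓞 K) ∈ P := by
    rintro P ⟨_, hLO⟩
    have h1 : (q : ℤ) ∈ Ideal.span {(q : ℤ)} := Ideal.mem_span_singleton_self _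
    rw [hLO.over, Ideal.mem_comap] at h1
    simpa using h1
  have hnebot : ∀ P ∈ (Ideal.span {(q : ℤ)}).primesOver (𝓞 K), P ≠ ⊥ := by
    intro P hP hbot
    have := hmemq P hP
    rw [hbot, Ideal.mem_bot] at this
    exact hq.ne_zero (by exact_mod_cast this)
  let v₁ : HeightOneSpectrum (𝓞 K) := ⟨P₁, hP₁.1, hnebot P₁ hP₁⟩
  let v₂ : HeightOneSpectrum (𝓞 K) := ⟨P₂, hP₂.1, hnebot P₂ hP₂⟩
  have hunder : ∀ v : HeightOneSpectrum (𝓞 K), ((q : ℕ) : 𝓞 K) ∈ v.asIdeal →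
      v.under (𝓞 ℚ) = (Rat.HeightOneSpectrum.primesEquiv (R := 𝓞 ℚ)).symm ⟨q, hq⟩ := fun v hv ↦
    (natCast_mem_asIdeal_iff_eq_primesEquiv_symm (v.under (𝓞 ℚ)) hq).mp
      (LocalField.natCast_mem_under q v hv)
  have h12 : v₁.under (𝓞 ℚ) = v₂.under (𝓞 ℚ) := by
    rw [hunder v₁ (hmemq P₁ hP₁), hunder v₂ (hmemq P₂ hP₂)]
  obtain ⟨σ, hσ⟩ := HeightOneSpectrum.exists_algEquiv_smul_eq ℚ h12
  have hσ1 : σ ≠ 1 := by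
    rintro rfl
    rw [one_smul] at hσ
    exact hne (congrArg HeightOneSpectrum.asIdeal hσ)
  have hcard : Nat.card (K ≃ₐ[ℚ] K) = 2 := by rw [IsGalois.card_aut_eq_finrank, hK.1]
  obtain ⟨y, -, hyu⟩ := (Nat.card_eq_two_iff' (1 : K ≃ₐ[ℚ] K)).mp hcard
  have hστ : σ = τ := (hyu σ hσ1).trans (hyu τ hτ).symm
  refine ⟨v₁, ?_, ?_, hmemq P₁ hP₁⟩
  · rw [← hστ, hσ]
    exact fun h ↦ hne (congrArg HeightOneSpectrum.asIdeal h).symm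
  · obtain ⟨r, hr⟩ := hqN
    rw [hr, Nat.cast_mul]
    exact v₁.asIdeal.mul_mem_right _ (hmemq P₁ hP₁)

/-- **The stringent carrier without the Heegner hypothesis.** tam3-p1's `JET.Walk.exists_stringentCarrier` VERBATIM with
`SatisfiesHeegnerHypothesis (W.conductorNorm ℤ) K` replaced by `hsp`: every prime `q ∣ N_E` lying under the stub's place `v` of `ℚ`
(the place with `p ∣ c_v(E)`) has exactly two primes of `K` above it — the frame clause of the Shimura port targets at `q ∉ S`.
Conclusion unchanged: a place `v₀` of `K` moved by `τ` with `N ∈ v₀`, `N ∈ τ • v₀`; `𝒮 := stringentFamily ≤ Kum`; `τ`-stability on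
`{v₀, τ • v₀}`; (δ) `Kum_{v₀}∕𝒮_{v₀}` cyclic of order `p^{ord_p c_v(E)}`. [cite: Jetchev2008, Lemma 3.2 (p. 814), (δ) (p. 822)]
[cite: CasselsFrohlichANT1967, Ch. VII Prop. 1.2 (ii)] [cite: SilvermanAEC2009, X.§4] -/
theorem exists_stringentCarrier_of_ncard_eq_two (W : WeierstrassCurve ℚ) [W.IsElliptic] [W.IsGloballyMinimal]
    (K : Type) [Field K] [NumberField K] (hK : IsImaginaryQuadratic K) (τ : K ≃ₐ[ℚ] K) (hτ : τ ≠ 1)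
    (p : ℕ) [Fact p.Prime] (hp2 : p ≠ 2)
    (hΦ : ∀ (W : WeierstrassCurve ℚ) [W.IsElliptic] [W.IsGloballyMinimal] (ℓ p : ℕ) [Fact ℓ.Prime]
      [Fact p.Prime], p ≠ 2 → p ∣ (W.baseChange ℚ_[ℓ]).localTamagawaNumber ℤ_[ℓ] →
      ∀ [(W.baseChange ℚ_[ℓ]).IsMinimal ℤ_[ℓ]],
      IsAddCyclic ((W.baseChange ℚ_[ℓ]).toAffine.Point ⧸ (W.baseChange ℚ_[ℓ]).goodReductionSubgroup ℤ_[ℓ]))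
    (v : HeightOneSpectrum (𝓞 ℚ)) (ht : 1 ≤ padicValNat p (W.tamagawaNumberAt v))
    (hsp : ∀ q : ℕ, q.Prime → q ∣ W.conductorNorm ℤ → ((q : ℕ) : 𝓞 ℚ) ∈ v.asIdeal →
      ((Ideal.span {(q : ℤ)}).primesOver (𝓞 K)).ncard = 2)
    (k : ℕ) (hn : ((p ^ k : ℕ) : ℤ) ≠ 0) (htk : padicValNat p (W.tamagawaNumberAt v) ≤ k) :
    ∃ v₀ : HeightOneSpectrum (𝓞 K), τ • v₀ ≠ v₀ ∧
      ((W.conductorNorm ℤ : ℕ) : 𝓞 K) ∈ v₀.asIdeal ∧ ((W.conductorNorm ℤ : ℕ) : 𝓞 K) ∈ (τ • v₀).asIdeal ∧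
      (∀ w, stringentFamily W K hn w ≤ (W.baseChange K).kummerSelmerStructure ((p ^ k : ℕ) : ℤ) w) ∧
      (∀ (v w : HeightOneSpectrum (𝓞 K)) (h : τ • v = w), v ∈ ({v₀, τ • v₀} : Finset _) →
        ∀ x : galoisCohomology (((W.baseChange K).torsionGaloisModule ((p ^ k : ℕ) : ℤ)).toLocal
          (Sum.inr v : Place K)) 1,
        x ∈ stringentFamily W K hn (Sum.inr v) →
          conjActPlace W τ ((p ^ k : ℕ) : ℤ) h x ∈ stringentFamily W K hn (Sum.inr w)) ∧
      IsAddCyclic (↥((W.baseChange K).kummerSelmerStructure ((p ^ k : ℕ) : ℤ) (Sum.inr v₀)) ⧸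
        (stringentFamily W K hn (Sum.inr v₀)).addSubgroupOf
          ((W.baseChange K).kummerSelmerStructure ((p ^ k : ℕ) : ℤ) (Sum.inr v₀))) ∧
      (stringentFamily W K hn (Sum.inr v₀)).relIndex
          ((W.baseChange K).kummerSelmerStructure ((p ^ k : ℕ) : ℤ) (Sum.inr v₀)) =
        p ^ padicValNat p (W.tamagawaNumberAt v) := by
  -- adapted verbatim from tam3-p1's `JET.Walk.exists_stringentCarrier` (`exists_split_place_of_dvd` ↦ `…_of_ncard_eq_two`)
  have hp : p.Prime := Fact.out
  obtain ⟨q, hqF, hqv, hqN, hcq⟩ := exists_prime_under_of_padicValNat_pos W p v ht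
  haveI := hqF
  obtain ⟨v₀, hv₀, hv₀N, hqv₀⟩ := exists_split_place_of_ncard_eq_two K hK τ hτ q (hsp q hqF.out hqN hqv) hqN
  have hv₀N' : ((W.conductorNorm ℤ : ℕ) : 𝓞 K) ∈ (τ • v₀).asIdeal := by
    have := (HeightOneSpectrum.smul_mem_smul_asIdeal_iff τ v₀ ((W.conductorNorm ℤ : ℕ) : 𝓞 K)).mpr hv₀N
    rwa [GlobalDuality.smul_natCast_ringOfIntegers] at this
  obtain ⟨hminK, hminP, hcEq, hc0, hcyc⟩ := carrierRowData_of_split W K q hK τ v₀ hv₀ hqv₀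
  haveI := hminK
  haveI := hminP
  have hpc : p ∣ (W.baseChange ℚ_[q]).localTamagawaNumber ℤ_[q] := by
    rw [hcq]; exact dvd_of_one_le_padicValNat ht
  haveI := hcyc (hΦ W q p hp2 hpc)
  have hfac : (((W.baseChange K).baseChange (v₀.adicCompletion K)).localTamagawaNumber
      (v₀.adicCompletionIntegers K)).factorization p = padicValNat p (W.tamagawaNumberAt v) := by
    rw [hcEq, hcq, Nat.factorization_def _ hp]
  refine ⟨v₀, hv₀, hv₀N, hv₀N', fun w ↦ stringentFamily_le_kummer W K hn w,
    fun v' w h _ x hx ↦ conjActPlace_mem_stringentFamily W τ hn h hx,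
    isAddCyclic_kummer_quotient_stringentFamily W K hn v₀, ?_⟩
  rw [← hfac]
  exact relIndex_stringentFamily_eq_pow W K hp k hn v₀ hc0 (by rw [hfac]; exact htk)

end Summit.BirchSwinnertonDyer.BirchSwinnertonDyer.Theorems.ShimuraWalk

end
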